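import Literature.Analysis.FunctionSpaces.TorusSobolevL6
import Literature.Analysis.FunctionSpaces.TorusTrilinearH1
import Literature.Analysis.FunctionSpaces.TorusLowOrderLeibniz
import HarnessLib

/-!
# The weighted Sobolev inequality `‖u‖_{L^{3a}}^a ≤ c_a ∫ |∇u|² |u|^{a−2}` for zero-mean fields on `T³`
# (Robinson–Sadowski 2014, Lemma 2, periodic case)

Analysis/FunctionSpaces proof file (theorems only; no definitions, no named facts).
Search for candidate a priori estimates; no regularity claim.

Robinson–Sadowski, Rend. Sem. Mat. Univ. Padova 131 (2014), Lemma 2 (p. 164): "Take `2 ≤ p < 3`.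
Then there exists a constant `c_p` such for every `u ∈ W^{1,p}(ℝ³)` we have `u ∈ L^{3a}(ℝ³)` and
`‖u‖_{L^{3a}}^a ≤ c_p ∫ |∇u|² |u|^{a−2}`, where `a = p/(3 − p)`. The same result is true if `V` is a
bounded (perhaps periodic) domain and `u ∈ W^{1,p}(V)` with `∫_V u = 0` or `u|_{∂V} = 0`."
This is the coercive input of the `L^a` energy method for Navier–Stokes (Beirão da Veiga 1987 on
`ℝ³`; Robinson–Sadowski 2014, Theorem 8 on `T³`), behind the rate-of-growth bound
`(1/q) d/dt ‖u‖_q^q ≤ C ν^{−(q+3)/(q−3)} ‖u‖_q^{q(q−1)/(q−3)}` (`q > 3`) whose sharpness is the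
subject of Bleitner–Protas 2026 (arXiv:2607.02739, eq. (5)).

Here, on the unit flat torus `T^d` with `card d = 3`, for every real `a > 2` (the case `a = 2` is
the mean-zero Sobolev embedding `H¹ ⊂ L⁶`, tree `Torus.lintegral_enorm_pow_six_le_cube_of_isSmooth`
with Poincaré–Wirtinger) and smooth zero-mean vector fields `u : T^d → ℝ^d`:

* `Torus.exists_integral_norm_rpow_three_mul_le_cube` —
  `∫ ‖u‖^{3a} ≤ K (∫ ‖u‖^{a−2} ∑ₖ ‖∂ₖu‖²)³`;
* `Torus.exists_rpow_integral_norm_rpow_le_weighted` — the printed shape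
  `(∫ ‖u‖^{3a})^{1/3} = ‖u‖_{3a}^a ≤ c ∫ ‖u‖^{a−2} ∑ₖ ‖∂ₖu‖²`.

PROOF. The printed periodic proof (pp. 165–167) argues by contradiction through the Rellich–
Kondrachov compactness theorem and yields no constant. We give instead a constructive argument
(constants existential only through the tree's Sobolev constant): put `s = (a−2)/2 > 0`,
`W = ‖u‖^s u` (so `‖W‖² = ‖u‖^a`, `‖W‖⁶ = ‖u‖^{3a}`) and `c = ∫ W`.  (i) MEAN CONTROL from the
zero mean of `u`: the radial map `g(w) = ‖w‖^{β−1} w`, `β = 1/(1+s)`, inverts `W ↦ u` and is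
`β`-Hölder with constant `3`, so `g(c) = ∫ (g(c) − g(W))` gives `‖c‖^β ≤ 3 ∫‖W − c‖^β ≤
3 (∫‖W − c‖⁶)^{β/6}` (Jensen twice), i.e. `‖c‖⁶ ≤ 3^{6(1+s)} ∫‖W − c‖⁶`; hence
`∫‖W‖⁶ ≤ 32 (1 + 3^{6(1+s)}) ∫‖W − c‖⁶`.  (ii) OSCILLATION through the smooth regularisation
`W_ε = (‖u‖² + ε)^{s/2} u` (`ε > 0`): `W_ε − ∫W_ε` is smooth with zero mean, so the mean-zero
embedding `H¹(T³) ⊂ L⁶(T³)` gives `∫‖W_ε − ∫W_ε‖⁶ ≤ C_S (∫∑ₖ‖∂ₖW_ε‖²)³`, and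
`‖∂ₖW_ε‖ ≤ (1+s)(‖u‖² + ε)^{s/2}‖∂ₖu‖`.  (iii) `ε → 0⁺`: both sides are parametric integrals of
jointly continuous integrands over the compact torus, hence continuous in `ε ∈ [0, 1]`.
Deviation from print: classical smooth fields in place of `W^{1,p}`; vector fields with values in
`ℝ^d` (the case needed for the velocity); constants inexplicit.

## Mathlib / tree search

Tree (used): `Torus.lintegral_enorm_pow_six_le_cube_of_isSmooth` (`TorusSobolevL6`),
`Torus.integral_norm_sq_le_of_hasZeroMean`, `Torus.integral_norm_fderiv_sq_le_card_mul_gradNormSq`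
(`TorusTrilinearH1`), `Torus.IsSmooth.comp_of_contDiffOn`, `Torus.partialDeriv_comp_of_contDiffOn`
(`TorusLowOrderLeibniz`), `Torus.partialDeriv_smul`, `Torus.partialDeriv_inner`
(`TorusCalculusProofs`); Mathlib `integral_mul_le_Lp_mul_Lq_of_nonneg`,
`continuous_parametric_integral_of_continuous`, `Real.rpow_*`. Searched (`lean search`):
`weighted.*Sobolev|norm_rpow_le_weighted|rpow_smul_sub_le|3 \* a` — the constructive argument exists
on the Summits side of this project (`Summit.NavierStokesRegularity.FunctionalMining.NonlinearPoincare.*`,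
`VelocityL4/L6NonlinearPoincare`, at the `L²` (Poincaré) level: `∫‖u‖^{2s+2} ≤ C∫‖u‖^{2s}|∇u|²`),
which Literature files may not import; the `L⁶`-level statement printed by Robinson–Sadowski is
not in the tree. The radial Hölder map and the regularisation lemmas below follow those files.

## References

* J. C. Robinson, W. Sadowski, *A local smoothness criterion for solutions of the 3D Navier–Stokes
  equations*, Rend. Semin. Mat. Univ. Padova 131 (2014) 159–178, Lemma 2 and Theorem 8
  (held: paper:doi-10-4171-rsmup-131-9, pp. 6–9, 17–18). [RobinsonSadowski2014]
* F. Bleitner, B. Protas, *On the sharpness of bounds on the rate of growth of Lebesgue norms of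
  the velocity in Navier–Stokes flows*, arXiv:2607.02739 (2026), eq. (5) and Appendix A
  (held: paper:arxiv-2607.02739). [BleitnerProtas2026]
* L. C. Evans, *Partial Differential Equations*, 2nd ed., AMS 2010, §5.6.1 Thm. 1. [Evans2010]
-/

noncomputable section

open MeasureTheory Finset Set Filter Topology
open scoped InnerProductSpace RealInnerProductSpace ContDiff NNReal ENNReal

namespace Literature.Analysis.FunctionSpaces

namespace Torus

variable {d : Type*} [Fintype d] [DecidableEq d]

namespace WeightedSobolev

/-! ## 1. The radial map `w ↦ ‖w‖^{β−1} w` is `β`-Hölder -/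

section Holder

variable {E : Type*} [NormedAddCommGroup E] [NormedSpace ℝ E]

/-- For `0 ≤ t ≤ 1` and `0 < β ≤ 1`: `t^β − t ≤ (1 − t)^β`. [folklore] -/
private theorem rpow_sub_self_le {t β : ℝ} (ht0 : 0 ≤ t) (ht1 : t ≤ 1) (hβ0 : 0 < β)
    (hβ1 : β ≤ 1) : t ^ β - t ≤ (1 - t) ^ β := by
  have h1 : t ^ β ≤ 1 := Real.rpow_le_one ht0 ht1 hβ0.le
  have h3 : 1 - t ≤ (1 - t) ^ β := by
    have h := Real.rpow_le_rpow_of_exponent_ge' (x := 1 - t) (by linarith) (by linarith) hβ0.le hβ1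
    rwa [Real.rpow_one] at h
  linarith

/-- The radial map `g(w) = ‖w‖^{β−1} w` is `β`-Hölder with constant `3` (`0 < β ≤ 1`, any real
normed space): `‖g x − g y‖ ≤ 3 ‖x − y‖^β`. [folklore] -/
private theorem norm_rpow_smul_sub_le {β : ℝ} (hβ0 : 0 < β) (hβ1 : β ≤ 1) (x y : E) :
    ‖‖x‖ ^ (β - 1) • x - ‖y‖ ^ (β - 1) • y‖ ≤ 3 * ‖x - y‖ ^ β := by
  wlog hxy : ‖y‖ ≤ ‖x‖ generalizing x y
  · have h := this y x (le_of_not_ge hxy)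
    rw [norm_sub_rev y x] at h
    rwa [norm_sub_rev]
  rcases eq_or_ne x 0 with hx | hx
  · have hy : y = 0 := by
      rw [hx, norm_zero] at hxy
      exact norm_le_zero_iff.1 hxy
    subst hx; subst hy
    simp [Real.zero_rpow hβ0.ne']
  obtain ⟨r, hr⟩ : ∃ r : ℝ, r = ‖x‖ := ⟨_, rfl⟩
  have hr0 : 0 < r := by rw [hr]; exact norm_pos_iff.2 hx
  have hyr : ‖y‖ ≤ r := by rw [hr]; exact hxy
  have hdec : ‖x‖ ^ (β - 1) • x - ‖y‖ ^ (β - 1) • y =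
      r ^ (β - 1) • (x - y) + (r ^ (β - 1) - ‖y‖ ^ (β - 1)) • y := by
    rw [smul_sub, sub_smul, ← hr]; abel
  -- first term
  have h1 : ‖r ^ (β - 1) • (x - y)‖ ≤ 2 * ‖x - y‖ ^ β := by
    rw [norm_smul, Real.norm_of_nonneg (Real.rpow_nonneg hr0.le _)]
    rcases eq_or_ne ‖x - y‖ 0 with h0 | h0
    · rw [h0, Real.zero_rpow hβ0.ne']; simp
    have hD0 : 0 < ‖x - y‖ := lt_of_le_of_ne (norm_nonneg _) (Ne.symm h0)
    have hD : ‖x - y‖ ≤ 2 * r := by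
      calc ‖x - y‖ ≤ ‖x‖ + ‖y‖ := norm_sub_le _ _
        _ ≤ 2 * r := by rw [← hr]; linarith
    have e : ‖x - y‖ ^ (1 - β) * ‖x - y‖ ^ β = ‖x - y‖ := by
      rw [← Real.rpow_add hD0, show (1 : ℝ) - β + β = 1 by ring, Real.rpow_one]
    have e2 : ‖x - y‖ ^ (1 - β) ≤ (2 * r) ^ (1 - β) :=
      Real.rpow_le_rpow (norm_nonneg _) hD (by linarith)
    have e3 : r ^ (β - 1) * (2 * r) ^ (1 - β) = 2 ^ (1 - β) := by
      rw [Real.mul_rpow (by norm_num) hr0.le]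
      have : r ^ (β - 1) * r ^ (1 - β) = 1 := by
        rw [← Real.rpow_add hr0, show β - 1 + (1 - β) = 0 by ring, Real.rpow_zero]
      calc r ^ (β - 1) * ((2 : ℝ) ^ (1 - β) * r ^ (1 - β))
          = 2 ^ (1 - β) * (r ^ (β - 1) * r ^ (1 - β)) := by ring
        _ = 2 ^ (1 - β) := by rw [this, mul_one]
    have e4 : (2 : ℝ) ^ (1 - β) ≤ 2 := by
      calc (2 : ℝ) ^ (1 - β) ≤ (2 : ℝ) ^ (1 : ℝ) :=
            Real.rpow_le_rpow_of_exponent_le (by norm_num) (by linarith)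
        _ = 2 := Real.rpow_one 2
    have hb0 : 0 ≤ ‖x - y‖ ^ β := Real.rpow_nonneg (norm_nonneg _) _
    calc r ^ (β - 1) * ‖x - y‖ = r ^ (β - 1) * (‖x - y‖ ^ (1 - β) * ‖x - y‖ ^ β) := by rw [e]
      _ ≤ r ^ (β - 1) * ((2 * r) ^ (1 - β) * ‖x - y‖ ^ β) :=
          mul_le_mul_of_nonneg_left (mul_le_mul_of_nonneg_right e2 hb0)
            (Real.rpow_nonneg hr0.le _)
      _ = (r ^ (β - 1) * (2 * r) ^ (1 - β)) * ‖x - y‖ ^ β := by ring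
      _ = 2 ^ (1 - β) * ‖x - y‖ ^ β := by rw [e3]
      _ ≤ 2 * ‖x - y‖ ^ β := mul_le_mul_of_nonneg_right e4 hb0
  -- second term
  have h2 : ‖(r ^ (β - 1) - ‖y‖ ^ (β - 1)) • y‖ ≤ ‖x - y‖ ^ β := by
    rcases eq_or_ne y 0 with hy | hy
    · rw [hy, smul_zero, norm_zero]; exact Real.rpow_nonneg (norm_nonneg _) _
    obtain ⟨s, hs⟩ : ∃ s : ℝ, s = ‖y‖ := ⟨_, rfl⟩
    have hs0 : 0 < s := by rw [hs]; exact norm_pos_iff.2 hy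
    have hsr : s ≤ r := by rw [hs]; exact hyr
    obtain ⟨t, ht⟩ : ∃ t : ℝ, t = s / r := ⟨_, rfl⟩
    have ht0 : 0 < t := by rw [ht]; exact div_pos hs0 hr0
    have ht1 : t ≤ 1 := by rw [ht]; exact (div_le_one hr0).2 hsr
    have hst : s = t * r := by rw [ht]; field_simp
    rw [norm_smul, Real.norm_eq_abs, ← hs, abs_of_nonpos (by
      linarith [Real.rpow_le_rpow_of_nonpos hs0 hsr (by linarith : β - 1 ≤ 0)]), neg_sub]
    have key : (s ^ (β - 1) - r ^ (β - 1)) * s = r ^ β * (t ^ β - t) := by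
      have a1 : s ^ (β - 1) * s = s ^ β := by
        calc s ^ (β - 1) * s = s ^ (β - 1) * s ^ (1 : ℝ) := by rw [Real.rpow_one]
          _ = s ^ β := by rw [← Real.rpow_add hs0, show β - 1 + 1 = β by ring]
      have a2 : s ^ β = t ^ β * r ^ β := by rw [hst, Real.mul_rpow ht0.le hr0.le]
      have a3 : r ^ (β - 1) * s = t * r ^ β := by
        rw [hst]
        calc r ^ (β - 1) * (t * r) = t * (r ^ (β - 1) * r ^ (1 : ℝ)) := by
              rw [Real.rpow_one]; ring
          _ = t * r ^ β := by rw [← Real.rpow_add hr0, show β - 1 + 1 = β by ring]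
      calc (s ^ (β - 1) - r ^ (β - 1)) * s = s ^ (β - 1) * s - r ^ (β - 1) * s := by ring
        _ = t ^ β * r ^ β - t * r ^ β := by rw [a1, a2, a3]
        _ = r ^ β * (t ^ β - t) := by ring
    have key2 : r ^ β * (1 - t) ^ β ≤ ‖x - y‖ ^ β := by
      have b1 : r * (1 - t) = r - s := by rw [hst]; ring
      have b2 : r - s ≤ ‖x - y‖ := by rw [hr, hs]; exact norm_sub_norm_le x y
      have b3 : 0 ≤ r * (1 - t) := by rw [b1]; linarith
      calc r ^ β * (1 - t) ^ β = (r * (1 - t)) ^ β := by rw [Real.mul_rpow hr0.le (by linarith)]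
        _ ≤ ‖x - y‖ ^ β := Real.rpow_le_rpow b3 (by rw [b1]; exact b2) hβ0.le
    rw [key]
    calc r ^ β * (t ^ β - t) ≤ r ^ β * (1 - t) ^ β :=
          mul_le_mul_of_nonneg_left (rpow_sub_self_le ht0.le ht1 hβ0 hβ1)
            (Real.rpow_nonneg hr0.le _)
      _ ≤ ‖x - y‖ ^ β := key2
  calc ‖‖x‖ ^ (β - 1) • x - ‖y‖ ^ (β - 1) • y‖
      = ‖r ^ (β - 1) • (x - y) + (r ^ (β - 1) - ‖y‖ ^ (β - 1)) • y‖ := by rw [hdec]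
    _ ≤ ‖r ^ (β - 1) • (x - y)‖ + ‖(r ^ (β - 1) - ‖y‖ ^ (β - 1)) • y‖ := norm_add_le _ _
    _ ≤ 2 * ‖x - y‖ ^ β + ‖x - y‖ ^ β := add_le_add h1 h2
    _ = 3 * ‖x - y‖ ^ β := by ring

/-- The radial map inverts `w = ‖v‖^s v`: with `β = 1/(1+s)`, `‖w‖^{β−1} w = v`. [folklore] -/
private theorem rpow_smul_rpow_smul {s β : ℝ} (hs : 0 < s) (hβ : β = (1 + s)⁻¹) (v : E) :
    ‖‖v‖ ^ s • v‖ ^ (β - 1) • (‖v‖ ^ s • v) = v := by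
  rcases eq_or_ne v 0 with hv | hv
  · subst hv; simp
  have hn : 0 < ‖v‖ := norm_pos_iff.2 hv
  have h1 : ‖‖v‖ ^ s • v‖ = ‖v‖ ^ (s + 1) := by
    rw [norm_smul, Real.norm_of_nonneg (Real.rpow_nonneg hn.le _), Real.rpow_add hn,
      Real.rpow_one]
  have hs1 : (1 + s) ≠ 0 := by linarith
  have h2 : (‖v‖ ^ (s + 1)) ^ (β - 1) = ‖v‖ ^ (-s) := by
    rw [← Real.rpow_mul hn.le]
    congr 1
    rw [hβ]; field_simp; ring
  rw [h1, h2, smul_smul, ← Real.rpow_add hn, neg_add_cancel, Real.rpow_zero, one_smul]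

end Holder

/-! ## 2. Real-exponent integral tools on `T^d` -/

omit [DecidableEq d] in
/-- Hölder on `T^d` with weights `a + b = 1` for continuous non-negative `f, g`:
`∫ f g ≤ (∫ f^{1/a})^a (∫ g^{1/b})^b`. [folklore] -/
private theorem integral_mul_le_rpow_mul_rpow {f g : UnitAddTorus d → ℝ} (hf : Continuous f)
    (hg : Continuous g) (hf0 : ∀ x, 0 ≤ f x) (hg0 : ∀ x, 0 ≤ g x) {a b : ℝ} (ha : 0 < a)
    (hb : 0 < b) (hab : a + b = 1) :
    ∫ x, f x * g x ≤ (∫ x, f x ^ a⁻¹) ^ a * (∫ x, g x ^ b⁻¹) ^ b := by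
  have hpq : (a⁻¹).HolderConjugate b⁻¹ := Real.HolderConjugate.inv_inv ha hb hab
  have h := integral_mul_le_Lp_mul_Lq_of_nonneg (μ := volume) hpq (ae_of_all _ hf0)
    (ae_of_all _ hg0) (hf.memLp_of_hasCompactSupport (HasCompactSupport.of_compactSpace f))
    (hg.memLp_of_hasCompactSupport (HasCompactSupport.of_compactSpace g))
  simpa only [one_div, inv_inv] using h

omit [DecidableEq d] in
/-- Jensen on `T^d` for the concave power `t ↦ t^β`, `0 < β ≤ 1`: for continuous `f ≥ 0`,
`∫ f^β ≤ (∫ f)^β`. [folklore] -/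
private theorem integral_rpow_le_rpow_integral {f : UnitAddTorus d → ℝ} (hf : Continuous f)
    (hf0 : ∀ x, 0 ≤ f x) {β : ℝ} (hβ0 : 0 < β) (hβ1 : β ≤ 1) :
    ∫ x, f x ^ β ≤ (∫ x, f x) ^ β := by
  rcases hβ1.eq_or_lt with h1 | h1
  · subst h1; simp only [Real.rpow_one]; exact le_rfl
  have hb : 0 < 1 - β := by linarith
  have h := integral_mul_le_rpow_mul_rpow (f := fun x => f x ^ β) (g := fun _ => (1 : ℝ))
    (hf.rpow_const fun x => Or.inr hβ0.le) continuous_const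
    (fun x => Real.rpow_nonneg (hf0 x) _) (fun _ => zero_le_one) hβ0 hb (by ring)
  have e1 : ∀ x, (f x ^ β) ^ β⁻¹ = f x := fun x => by
    rw [← Real.rpow_mul (hf0 x), mul_inv_cancel₀ hβ0.ne', Real.rpow_one]
  simp only [mul_one, e1, Real.one_rpow, integral_const, smul_eq_mul, probReal_univ] at h
  exact h

omit [DecidableEq d] in
/-- Power mean on `T^d`: `∫ f ≤ (∫ f⁶)^{1/6}` for continuous `f ≥ 0`. [folklore] -/
private theorem integral_le_rpow_integral_pow_six {f : UnitAddTorus d → ℝ} (hf : Continuous f)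
    (hf0 : ∀ x, 0 ≤ f x) : ∫ x, f x ≤ (∫ x, f x ^ 6) ^ (1 / 6 : ℝ) := by
  have h := integral_rpow_le_rpow_integral (f := fun x => f x ^ 6) (hf.pow 6)
    (fun x => pow_nonneg (hf0 x) 6) (β := 1 / 6) (by norm_num) (by norm_num)
  have e : ∀ x, (f x ^ 6) ^ (1 / 6 : ℝ) = f x := fun x => by
    rw [← Real.rpow_natCast, ← Real.rpow_mul (hf0 x)]; norm_num
  simp only [e] at h
  exact h

omit [DecidableEq d] in
/-- Continuity of `ε ↦ ∫_{T^d} F(ε, x) dx` for jointly continuous `F`. [folklore] -/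
private theorem continuous_integral_param {E' : Type*} [NormedAddCommGroup E']
    [NormedSpace ℝ E'] {F : ℝ → UnitAddTorus d → E'} (hF : Continuous (Function.uncurry F)) :
    Continuous fun ε => ∫ x, F ε x := by
  have h := continuous_parametric_integral_of_continuous (μ := volume) hF isCompact_univ
  simpa only [Measure.restrict_univ] using h

/-! ## 3. The smooth regularisation `W_ε = (‖u‖² + ε)^{s/2} u` -/

omit [DecidableEq d] in
/-- The radial weight `(‖u‖² + ε)^r` is smooth for `ε > 0`. [folklore] -/
private theorem isSmooth_rpow_normSq_add {u : UnitAddTorus d → EuclideanSpace ℝ d}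
    (hu : IsSmooth u) {ε : ℝ} (hε : 0 < ε) (r : ℝ) :
    IsSmooth (fun x => (‖u x‖ ^ 2 + ε) ^ r) := by
  have hw : IsSmooth (fun x => ‖u x‖ ^ 2 + ε) :=
    (hu.norm_sq).add (isSmooth_const (d := d) (c := ε))
  have hφ : ContDiffOn ℝ ∞ (fun t : ℝ => t ^ r) (Set.Ioi 0) := fun y hy =>
    (Real.contDiffAt_rpow_const_of_ne (p := r) (ne_of_gt hy)).contDiffWithinAt
  exact IsSmooth.comp_of_contDiffOn hφ hw fun x => by
    show 0 < ‖u x‖ ^ 2 + ε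
    positivity

omit [DecidableEq d] in
/-- `W_ε = (‖u‖² + ε)^r u` is smooth for `ε > 0`. [folklore] -/
private theorem isSmooth_reg {u : UnitAddTorus d → EuclideanSpace ℝ d} (hu : IsSmooth u)
    {ε : ℝ} (hε : 0 < ε) (r : ℝ) : IsSmooth (fun x => (‖u x‖ ^ 2 + ε) ^ r • u x) :=
  (isSmooth_rpow_normSq_add hu hε r).smul' hu

/-- `∂ₖ(‖u‖² + ε) = 2⟪u, ∂ₖu⟫`. [folklore] -/
private theorem partialDeriv_normSq_add {u : UnitAddTorus d → EuclideanSpace ℝ d}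
    (hu : IsSmooth u) (ε : ℝ) (k : d) (x : UnitAddTorus d) :
    partialDeriv k (fun y => ‖u y‖ ^ 2 + ε) x = 2 * ⟪u x, partialDeriv k u x⟫ := by
  have hu1 : IsContDiff 1 u := hu.isContDiff (by simp)
  have e : (fun y => ‖u y‖ ^ 2 + ε) = (fun y => ⟪u y, u y⟫) + fun _ => ε := by
    funext y; simp only [Pi.add_apply, real_inner_self_eq_norm_sq]
  have hcst : IsContDiff 1 (fun _ : UnitAddTorus d => ε) := contDiff_const
  have hinn : IsContDiff 1 (fun y => ⟪u y, u y⟫) := ContDiff.inner ℝ hu1 hu1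
  have hc0 : partialDeriv k (fun _ : UnitAddTorus d => ε) x = 0 := by
    simp [Torus.partialDeriv, Torus.lineDeriv]
  rw [e, partialDeriv_add hinn hcst, Pi.add_apply, partialDeriv_inner hu1 hu1, hc0, add_zero,
    real_inner_comm (partialDeriv k u x) (u x)]
  ring

/-- `∂ₖ(‖u‖² + ε)^r = r (‖u‖² + ε)^{r−1} · 2⟪u, ∂ₖu⟫` for `ε > 0`. [folklore] -/
private theorem partialDeriv_rpow_normSq_add {u : UnitAddTorus d → EuclideanSpace ℝ d}
    (hu : IsSmooth u) {ε : ℝ} (hε : 0 < ε) (r : ℝ) (k : d) (x : UnitAddTorus d) :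
    partialDeriv k (fun y => (‖u y‖ ^ 2 + ε) ^ r) x =
      r * (‖u x‖ ^ 2 + ε) ^ (r - 1) * (2 * ⟪u x, partialDeriv k u x⟫) := by
  have hw : IsSmooth (fun y => ‖u y‖ ^ 2 + ε) :=
    (hu.norm_sq).add (isSmooth_const (d := d) (c := ε))
  have hpos : ∀ y, 0 < ‖u y‖ ^ 2 + ε := fun y => by positivity
  have hφ : ContDiffOn ℝ ∞ (fun t : ℝ => t ^ r) (Set.Ioi 0) := fun y hy =>
    (Real.contDiffAt_rpow_const_of_ne (p := r) (ne_of_gt hy)).contDiffWithinAt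
  have h := partialDeriv_comp_of_contDiffOn hφ isOpen_Ioi hw (fun y => hpos y) k x
  have hderiv : deriv (fun t : ℝ => t ^ r) (‖u x‖ ^ 2 + ε) = r * (‖u x‖ ^ 2 + ε) ^ (r - 1) :=
    (Real.hasDerivAt_rpow_const (p := r) (Or.inl (hpos x).ne')).deriv
  change partialDeriv k (fun z => (fun t : ℝ => t ^ r) ((fun y => ‖u y‖ ^ 2 + ε) z)) x = _
  rw [h, hderiv, partialDeriv_normSq_add hu ε k x]

/-- Derivative bound for the regularisation: for `s ≥ 0`, `ε > 0`,
`‖∂ₖW_ε‖ ≤ (1 + s)(‖u‖² + ε)^{s/2}‖∂ₖu‖`. [folklore] -/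
private theorem norm_partialDeriv_reg_le {u : UnitAddTorus d → EuclideanSpace ℝ d}
    (hu : IsSmooth u) {s ε : ℝ} (hs : 0 ≤ s) (hε : 0 < ε) (k : d) (x : UnitAddTorus d) :
    ‖partialDeriv k (fun y => (‖u y‖ ^ 2 + ε) ^ (s / 2) • u y) x‖ ≤
      (1 + s) * (‖u x‖ ^ 2 + ε) ^ (s / 2) * ‖partialDeriv k u x‖ := by
  have hθ : IsContDiff 1 (fun y => (‖u y‖ ^ 2 + ε) ^ (s / 2)) :=
    (isSmooth_rpow_normSq_add hu hε (s / 2)).isContDiff (by simp)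
  have hu1 : IsContDiff 1 u := hu.isContDiff (by simp)
  rw [partialDeriv_smul hθ hu1, partialDeriv_rpow_normSq_add hu hε]
  obtain ⟨h, hh⟩ : ∃ h : ℝ, h = ‖u x‖ ^ 2 + ε := ⟨_, rfl⟩
  have hpos : 0 < h := by rw [hh]; positivity
  rw [← hh]
  have h1 : ‖h ^ (s / 2) • partialDeriv k u x‖ = h ^ (s / 2) * ‖partialDeriv k u x‖ := by
    rw [norm_smul, Real.norm_of_nonneg (Real.rpow_nonneg hpos.le _)]
  have hkey : h ^ (s / 2 - 1) * ‖u x‖ ^ 2 ≤ h ^ (s / 2) := by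
    have hu2 : ‖u x‖ ^ 2 ≤ h := by rw [hh]; linarith
    calc h ^ (s / 2 - 1) * ‖u x‖ ^ 2 ≤ h ^ (s / 2 - 1) * h :=
          mul_le_mul_of_nonneg_left hu2 (Real.rpow_nonneg hpos.le _)
      _ = h ^ (s / 2) := by
          calc h ^ (s / 2 - 1) * h = h ^ (s / 2 - 1) * h ^ (1 : ℝ) := by rw [Real.rpow_one]
            _ = h ^ (s / 2) := by rw [← Real.rpow_add hpos, sub_add_cancel]
  have h2 : ‖(s / 2 * h ^ (s / 2 - 1) * (2 * ⟪u x, partialDeriv k u x⟫)) • u x‖ ≤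
      s * h ^ (s / 2) * ‖partialDeriv k u x‖ := by
    rw [norm_smul, Real.norm_eq_abs]
    have hcs : |⟪u x, partialDeriv k u x⟫| ≤ ‖u x‖ * ‖partialDeriv k u x‖ :=
      abs_real_inner_le_norm _ _
    have hr0 : 0 ≤ h ^ (s / 2 - 1) := Real.rpow_nonneg hpos.le _
    calc |s / 2 * h ^ (s / 2 - 1) * (2 * ⟪u x, partialDeriv k u x⟫)| * ‖u x‖
        = s * h ^ (s / 2 - 1) * |⟪u x, partialDeriv k u x⟫| * ‖u x‖ := by
          rw [abs_mul, abs_mul, abs_mul, abs_of_nonneg (by positivity : (0 : ℝ) ≤ s / 2),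
            abs_of_nonneg hr0, abs_of_pos (by norm_num : (0 : ℝ) < 2)]
          ring
      _ ≤ s * h ^ (s / 2 - 1) * (‖u x‖ * ‖partialDeriv k u x‖) * ‖u x‖ := by gcongr
      _ = s * (h ^ (s / 2 - 1) * ‖u x‖ ^ 2) * ‖partialDeriv k u x‖ := by ring
      _ ≤ s * h ^ (s / 2) * ‖partialDeriv k u x‖ := by gcongr
  calc ‖h ^ (s / 2) • partialDeriv k u x +
        (s / 2 * h ^ (s / 2 - 1) * (2 * ⟪u x, partialDeriv k u x⟫)) • u x‖
      ≤ ‖h ^ (s / 2) • partialDeriv k u x‖ +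
          ‖(s / 2 * h ^ (s / 2 - 1) * (2 * ⟪u x, partialDeriv k u x⟫)) • u x‖ := norm_add_le _ _
    _ ≤ h ^ (s / 2) * ‖partialDeriv k u x‖ + s * h ^ (s / 2) * ‖partialDeriv k u x‖ := by
        rw [h1]; gcongr
    _ = (1 + s) * h ^ (s / 2) * ‖partialDeriv k u x‖ := by ring

/-- `gradNormSq W_ε ≤ (1+s)² ∫ (‖u‖² + ε)^s ∑ₖ‖∂ₖu‖²` for `s ≥ 0`, `ε > 0`. [folklore] -/
private theorem gradNormSq_reg_le {u : UnitAddTorus d → EuclideanSpace ℝ d} (hu : IsSmooth u)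
    {s ε : ℝ} (hs : 0 ≤ s) (hε : 0 < ε) :
    gradNormSq (fun y => (‖u y‖ ^ 2 + ε) ^ (s / 2) • u y) ≤
      (1 + s) ^ 2 * ∫ x, (‖u x‖ ^ 2 + ε) ^ s * ∑ k, ‖partialDeriv k u x‖ ^ 2 := by
  unfold gradNormSq
  have hW := isSmooth_reg hu hε (s / 2)
  have hpos : ∀ x, 0 < ‖u x‖ ^ 2 + ε := fun x => by positivity
  have hc1 : Continuous fun x =>
      ∑ k, ‖partialDeriv k (fun y => (‖u y‖ ^ 2 + ε) ^ (s / 2) • u y) x‖ ^ 2 :=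
    continuous_finsetSum _ fun k _ => (hW.partialDeriv k).continuous.norm.pow 2
  have hc2 : Continuous fun x => (‖u x‖ ^ 2 + ε) ^ s * ∑ k, ‖partialDeriv k u x‖ ^ 2 :=
    (((hu.continuous.norm.pow 2).add continuous_const).rpow_const fun x => Or.inr hs).mul
      (continuous_finsetSum _ fun k _ => (hu.partialDeriv k).continuous.norm.pow 2)
  rw [← integral_const_mul]
  refine integral_mono hc1.integrable_unitAddTorus (hc2.integrable_unitAddTorus.const_mul _)
    fun x => ?_
  simp only
  rw [Finset.mul_sum, Finset.mul_sum]
  refine Finset.sum_le_sum fun k _ => ?_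
  have h := norm_partialDeriv_reg_le hu hs hε k x
  have h0 : 0 ≤ ‖partialDeriv k (fun y => (‖u y‖ ^ 2 + ε) ^ (s / 2) • u y) x‖ := norm_nonneg _
  have hsq : ((‖u x‖ ^ 2 + ε) ^ (s / 2)) ^ 2 = (‖u x‖ ^ 2 + ε) ^ s := by
    rw [← Real.rpow_natCast, ← Real.rpow_mul (hpos x).le]; norm_num
  calc ‖partialDeriv k (fun y => (‖u y‖ ^ 2 + ε) ^ (s / 2) • u y) x‖ ^ 2
      ≤ ((1 + s) * (‖u x‖ ^ 2 + ε) ^ (s / 2) * ‖partialDeriv k u x‖) ^ 2 :=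
        pow_le_pow_left₀ h0 h 2
    _ = (1 + s) ^ 2 * ((‖u x‖ ^ 2 + ε) ^ s * ‖partialDeriv k u x‖ ^ 2) := by
        rw [← hsq]; ring

/-! ## 4. The mean-zero embedding `H¹(T³) ⊂ L⁶(T³)`, Bochner form -/

/-- The mean-zero Sobolev embedding on `T³`, Bochner form: `∫‖v‖⁶ ≤ C (gradNormSq v)³` for every
smooth mean-zero `v` (the tree's `Torus.lintegral_enorm_pow_six_le_cube_of_isSmooth`, Poincaré–
Wirtinger `Torus.integral_norm_sq_le_of_hasZeroMean` and `∫‖Dv‖² ≤ d · gradNormSq v`; the same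
derivation as `Torus.exists_integral_norm_pow_six_le_gradNormSq_cube` of
`FluidPDE/TorusNSChessboardTimeAverages`, repeated here to keep this file inside `FunctionSpaces`).
[cite: Evans2010, §5.6.1 Thm. 1] -/
private theorem exists_integral_norm_pow_six_le (hd : Fintype.card d = 3) :
    ∃ C : ℝ, 0 ≤ C ∧ ∀ v : UnitAddTorus d → EuclideanSpace ℝ d, IsSmooth v →
      HasZeroMean v → ∫ x, ‖v x‖ ^ 6 ≤ C * gradNormSq v ^ 3 := by
  obtain ⟨K, hK⟩ := lintegral_enorm_pow_six_le_cube_of_isSmooth (F' := EuclideanSpace ℝ d) hd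
  have hK0 : (0 : ℝ) ≤ K := NNReal.coe_nonneg K
  refine ⟨(K : ℝ) * (((Fintype.card d : ℝ) ^ 2 + 1) * Fintype.card d) ^ 3, by positivity,
    fun w hws hw0 => ?_⟩
  have hwc : Continuous w := hws.continuous
  have hDc : Continuous (Torus.fderiv w) := continuous_fderiv_of_isSmooth hws
  have hG0 : 0 ≤ gradNormSq w := gradNormSq_nonneg _
  have h6 := hK w hws
  have conv : ∀ {g : UnitAddTorus d → ℝ} (_ : Continuous g) (_ : ∀ x, 0 ≤ g x) (k : ℕ),
      ∫⁻ x, (ENNReal.ofReal (g x)) ^ k = ENNReal.ofReal (∫ x, g x ^ k) := by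
    intro g hg hg0 k
    have hi : Integrable (fun x => g x ^ k) volume := (hg.pow k).integrable_unitAddTorus
    rw [ofReal_integral_eq_lintegral_ofReal hi (ae_of_all _ fun x => pow_nonneg (hg0 x) k)]
    exact lintegral_congr fun x => (ENNReal.ofReal_pow (hg0 x) k).symm
  have e6 : ∫⁻ x, ‖w x‖ₑ ^ 6 = ENNReal.ofReal (∫ x, ‖w x‖ ^ 6) := by
    rw [← conv hwc.norm (fun x => norm_nonneg _) 6]
    exact lintegral_congr fun x => by rw [ofReal_norm]
  have e2 : ∫⁻ x, ‖w x‖ₑ ^ 2 = ENNReal.ofReal (∫ x, ‖w x‖ ^ 2) := by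
    rw [← conv hwc.norm (fun x => norm_nonneg _) 2]
    exact lintegral_congr fun x => by rw [ofReal_norm]
  have eD : ∫⁻ x, ‖Torus.fderiv w x‖ₑ ^ 2 = ENNReal.ofReal (∫ x, ‖Torus.fderiv w x‖ ^ 2) := by
    rw [← conv hDc.norm (fun x => norm_nonneg _) 2]
    exact lintegral_congr fun x => by rw [ofReal_norm]
  have hA0 : 0 ≤ ∫ x, ‖w x‖ ^ 2 := integral_nonneg fun x => sq_nonneg _
  have hB0 : 0 ≤ ∫ x, ‖Torus.fderiv w x‖ ^ 2 := integral_nonneg fun x => sq_nonneg _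
  rw [e6, e2, eD, ← ENNReal.ofReal_add hA0 hB0, ← ENNReal.ofReal_pow (by positivity),
    ← ENNReal.ofReal_coe_nnreal, ← ENNReal.ofReal_mul hK0] at h6
  have h6' : ∫ x, ‖w x‖ ^ 6 ≤ K * ((∫ x, ‖w x‖ ^ 2) + ∫ x, ‖Torus.fderiv w x‖ ^ 2) ^ 3 :=
    (ENNReal.ofReal_le_ofReal_iff (by positivity)).1 h6
  have hPoinc : ∫ x, ‖w x‖ ^ 2 ≤ (Fintype.card d : ℝ) ^ 2 * ∫ x, ‖Torus.fderiv w x‖ ^ 2 :=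
    integral_norm_sq_le_of_hasZeroMean hws hw0
  have hDw : ∫ x, ‖Torus.fderiv w x‖ ^ 2 ≤ Fintype.card d * gradNormSq w :=
    integral_norm_fderiv_sq_le_card_mul_gradNormSq hws
  have hsum2 : (∫ x, ‖w x‖ ^ 2) + ∫ x, ‖Torus.fderiv w x‖ ^ 2 ≤
      ((Fintype.card d : ℝ) ^ 2 + 1) * Fintype.card d * gradNormSq w := by
    have hd1 : (0 : ℝ) ≤ (Fintype.card d : ℝ) ^ 2 + 1 := by positivity
    calc (∫ x, ‖w x‖ ^ 2) + ∫ x, ‖Torus.fderiv w x‖ ^ 2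
        ≤ (Fintype.card d : ℝ) ^ 2 * (∫ x, ‖Torus.fderiv w x‖ ^ 2) +
            ∫ x, ‖Torus.fderiv w x‖ ^ 2 := by linarith [hPoinc]
      _ = ((Fintype.card d : ℝ) ^ 2 + 1) * ∫ x, ‖Torus.fderiv w x‖ ^ 2 := by ring
      _ ≤ ((Fintype.card d : ℝ) ^ 2 + 1) * (Fintype.card d * gradNormSq w) :=
          mul_le_mul_of_nonneg_left hDw hd1
      _ = ((Fintype.card d : ℝ) ^ 2 + 1) * Fintype.card d * gradNormSq w := by ring
  calc ∫ x, ‖w x‖ ^ 6 ≤ K * ((∫ x, ‖w x‖ ^ 2) + ∫ x, ‖Torus.fderiv w x‖ ^ 2) ^ 3 := h6'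
    _ ≤ K * (((Fintype.card d : ℝ) ^ 2 + 1) * Fintype.card d * gradNormSq w) ^ 3 := by
        gcongr
    _ = K * (((Fintype.card d : ℝ) ^ 2 + 1) * Fintype.card d) ^ 3 * gradNormSq w ^ 3 := by
        ring

/-! ## 5. Mean control from the zero mean of `u` -/

omit [DecidableEq d] in
/-- **Mean control.** For a continuous zero-mean field `u` on `T^d` and `s > 0`, with
`W = ‖u‖^s u` and `c = ∫ W`: `‖c‖⁶ ≤ 3^{6(1+s)} ∫‖W − c‖⁶` (zero mean of `u = ‖W‖^{β−1} W`,
`β = 1/(1+s)`, the `β`-Hölder bound of the radial map, Jensen). [folklore] -/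
private theorem norm_integral_pow_six_le {u : UnitAddTorus d → EuclideanSpace ℝ d}
    (hu : Continuous u) (h0 : ∫ x, u x = 0) {s : ℝ} (hs : 0 < s) :
    ‖∫ x, ‖u x‖ ^ s • u x‖ ^ 6 ≤
      ((3 : ℝ) ^ (1 + s)) ^ 6 * ∫ x, ‖‖u x‖ ^ s • u x - ∫ y, ‖u y‖ ^ s • u y‖ ^ 6 := by
  set W : UnitAddTorus d → EuclideanSpace ℝ d := fun x => ‖u x‖ ^ s • u x with hW
  set c : EuclideanSpace ℝ d := ∫ x, W x with hc
  obtain ⟨β, hβ⟩ : ∃ β : ℝ, β = (1 + s)⁻¹ := ⟨_, rfl⟩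
  have hs1 : 0 < 1 + s := by linarith
  have hβ0 : 0 < β := by rw [hβ]; exact inv_pos.2 hs1
  have hβ1 : β ≤ 1 := by rw [hβ]; exact inv_le_one_of_one_le₀ (by linarith)
  have hWc : Continuous W := (hu.norm.rpow_const fun _ => Or.inr hs.le).smul hu
  set Φ : ℝ := ∫ x, ‖W x - c‖ ^ 6 with hΦ
  have hΦ0 : 0 ≤ Φ := integral_nonneg fun x => pow_nonneg (norm_nonneg _) 6
  show ‖c‖ ^ 6 ≤ ((3 : ℝ) ^ (1 + s)) ^ 6 * Φ
  rcases eq_or_ne c 0 with hc0 | hc0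
  · rw [hc0, norm_zero]; simp only [ne_eq, OfNat.ofNat_ne_zero, not_false_eq_true, zero_pow]
    positivity
  have hcn : 0 < ‖c‖ := norm_pos_iff.2 hc0
  -- `g c = ∫ (g c − g (W x))`
  have hgW : ∀ x, ‖W x‖ ^ (β - 1) • W x = u x := fun x => rpow_smul_rpow_smul hs hβ (u x)
  have hgc : ‖c‖ ^ (β - 1) • c = ∫ x, (‖c‖ ^ (β - 1) • c - ‖W x‖ ^ (β - 1) • W x) := by
    simp_rw [hgW]
    rw [integral_sub (integrable_const _) hu.integrable_unitAddTorus, h0, sub_zero,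
      integral_const, probReal_univ, one_smul]
  -- `‖c‖^β ≤ 3 (Φ^{1/6})^β`
  have hstep : ‖c‖ ^ β ≤ 3 * (Φ ^ (1 / 6 : ℝ)) ^ β := by
    have e0 : ‖‖c‖ ^ (β - 1) • c‖ = ‖c‖ ^ β := by
      rw [norm_smul, Real.norm_of_nonneg (Real.rpow_nonneg hcn.le _)]
      calc ‖c‖ ^ (β - 1) * ‖c‖ = ‖c‖ ^ (β - 1) * ‖c‖ ^ (1 : ℝ) := by rw [Real.rpow_one]
        _ = ‖c‖ ^ β := by rw [← Real.rpow_add hcn, sub_add_cancel]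
    have hcont : Continuous fun x => ‖W x - c‖ := (hWc.sub continuous_const).norm
    have h1 : ‖c‖ ^ β ≤ 3 * ∫ x, ‖W x - c‖ ^ β := by
      rw [← e0, hgc]
      calc ‖∫ x, (‖c‖ ^ (β - 1) • c - ‖W x‖ ^ (β - 1) • W x)‖
          ≤ ∫ x, ‖‖c‖ ^ (β - 1) • c - ‖W x‖ ^ (β - 1) • W x‖ := norm_integral_le_integral_norm _
        _ ≤ ∫ x, 3 * ‖W x - c‖ ^ β := by
            refine integral_mono_of_nonneg (ae_of_all _ fun x => norm_nonneg _)
              ((hcont.rpow_const fun _ => Or.inr hβ0.le).const_mul 3).integrable_unitAddTorus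
              (ae_of_all _ fun x => ?_)
            have h := norm_rpow_smul_sub_le hβ0 hβ1 c (W x)
            rwa [norm_sub_rev c (W x)] at h
        _ = 3 * ∫ x, ‖W x - c‖ ^ β := integral_const_mul _ _
    have h2 : ∫ x, ‖W x - c‖ ^ β ≤ (∫ x, ‖W x - c‖) ^ β :=
      integral_rpow_le_rpow_integral hcont (fun x => norm_nonneg _) hβ0 hβ1
    have h3 : (∫ x, ‖W x - c‖) ^ β ≤ (Φ ^ (1 / 6 : ℝ)) ^ β :=
      Real.rpow_le_rpow (integral_nonneg fun x => norm_nonneg _)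
        (integral_le_rpow_integral_pow_six hcont fun x => norm_nonneg _) hβ0.le
    linarith [mul_le_mul_of_nonneg_left (h2.trans h3) (by norm_num : (0 : ℝ) ≤ 3)]
  -- raise to the power `1/β = 1 + s`, then to the sixth power
  have hΦ6 : 0 ≤ Φ ^ (1 / 6 : ℝ) := Real.rpow_nonneg hΦ0 _
  have e1 : (‖c‖ ^ β) ^ (1 + s) = ‖c‖ := by
    rw [← Real.rpow_mul hcn.le, hβ, inv_mul_cancel₀ hs1.ne', Real.rpow_one]
  have e2 : (3 * (Φ ^ (1 / 6 : ℝ)) ^ β) ^ (1 + s) = 3 ^ (1 + s) * Φ ^ (1 / 6 : ℝ) := by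
    rw [Real.mul_rpow (by norm_num) (Real.rpow_nonneg hΦ6 _), ← Real.rpow_mul hΦ6, hβ,
      inv_mul_cancel₀ hs1.ne', Real.rpow_one]
  have hc1 : ‖c‖ ≤ 3 ^ (1 + s) * Φ ^ (1 / 6 : ℝ) := by
    calc ‖c‖ = (‖c‖ ^ β) ^ (1 + s) := e1.symm
      _ ≤ (3 * (Φ ^ (1 / 6 : ℝ)) ^ β) ^ (1 + s) :=
          Real.rpow_le_rpow (Real.rpow_nonneg hcn.le _) hstep hs1.le
      _ = 3 ^ (1 + s) * Φ ^ (1 / 6 : ℝ) := e2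
  have e3 : (Φ ^ (1 / 6 : ℝ)) ^ 6 = Φ := by
    rw [← Real.rpow_natCast, ← Real.rpow_mul hΦ0]; norm_num
  calc ‖c‖ ^ 6 ≤ (3 ^ (1 + s) * Φ ^ (1 / 6 : ℝ)) ^ 6 := pow_le_pow_left₀ hcn.le hc1 6
    _ = ((3 : ℝ) ^ (1 + s)) ^ 6 * Φ := by rw [mul_pow, e3]

end WeightedSobolev

open WeightedSobolev

/-! ## 6. The weighted Sobolev inequality -/

/-- **Robinson–Sadowski 2014, Lemma 2 (periodic, zero-average case), cube form.** On the flat unit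
torus `T^d`, `card d = 3`, for every real `a > 2` there is `K ≥ 0` such that for every smooth
vector field `u : T^d → ℝ^d` with `∫ u = 0`,
`∫ ‖u‖^{3a} ≤ K (∫ ‖u‖^{a−2} ∑ₖ ‖∂ₖu‖²)³`,
i.e. `‖u‖_{L^{3a}}^{3a} ≤ K (∫ |u|^{a−2} |∇u|²)³`. Printed: "`‖u‖_{L^{3a}}^a ≤ c_p ∫ |∇u|² |u|^{a−2}`
… true if `V` is a bounded (perhaps periodic) domain and `∫_V u = 0`" (there for `u ∈ W^{1,p}`,
`a = p/(3−p)`, `2 ≤ p < 3`, by a compactness argument; here constructively for smooth fields, see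
the module docstring; the endpoint `a = 2` is the mean-zero embedding `H¹ ⊂ L⁶`).
[cite: RobinsonSadowski2014, Lemma 2 (p. 164; periodic case pp. 165–167)] -/
theorem exists_integral_norm_rpow_three_mul_le_cube (hd : Fintype.card d = 3) {a : ℝ}
    (ha : 2 < a) :
    ∃ K : ℝ, 0 ≤ K ∧ ∀ u : UnitAddTorus d → EuclideanSpace ℝ d, IsSmooth u → HasZeroMean u →
      ∫ x, ‖u x‖ ^ (3 * a) ≤
        K * (∫ x, ‖u x‖ ^ (a - 2) * ∑ k, ‖partialDeriv k u x‖ ^ 2) ^ 3 := by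
  obtain ⟨CS, hCS0, hCS⟩ := exists_integral_norm_pow_six_le (d := d) hd
  -- exponent of the radial map
  set s : ℝ := (a - 2) / 2 with hs_def
  have hs : 0 < s := by rw [hs_def]; linarith
  set M : ℝ := ((3 : ℝ) ^ (1 + s)) ^ 6 with hM
  have hM0 : 0 ≤ M := by positivity
  refine ⟨32 * (1 + M) * (CS * ((1 + s) ^ 2) ^ 3), by positivity, fun u hu h0 => ?_⟩
  have huc : Continuous u := hu.continuous
  have h0' : ∫ x, u x = 0 := h0
  -- the limiting objects
  set W : UnitAddTorus d → EuclideanSpace ℝ d := fun x => ‖u x‖ ^ s • u x with hW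
  set c : EuclideanSpace ℝ d := ∫ x, W x with hc
  have hWc : Continuous W := (huc.norm.rpow_const fun _ => Or.inr hs.le).smul huc
  set J : ℝ → ℝ := fun ε => ∫ x, (‖u x‖ ^ 2 + ε) ^ s * ∑ k, ‖partialDeriv k u x‖ ^ 2 with hJ
  have hcs : Continuous fun x => ∑ k, ‖partialDeriv k u x‖ ^ 2 :=
    continuous_finsetSum _ fun k _ => (hu.partialDeriv k).continuous.norm.pow 2
  have hcs0 : ∀ x, 0 ≤ ∑ k, ‖partialDeriv k u x‖ ^ 2 := fun x =>
    Finset.sum_nonneg fun k _ => sq_nonneg _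
  -- `J 0 = ∫ ‖u‖^{a-2} ∑‖∂ₖu‖²` and `∫‖u‖^{3a} = ∫‖W‖⁶`
  have hpow1 : ∀ x, (‖u x‖ ^ 2 + 0) ^ s = ‖u x‖ ^ (a - 2) := fun x => by
    rw [add_zero, ← Real.rpow_natCast, ← Real.rpow_mul (norm_nonneg _)]
    congr 1; rw [hs_def]; push_cast; ring
  have hJ0 : J 0 = ∫ x, ‖u x‖ ^ (a - 2) * ∑ k, ‖partialDeriv k u x‖ ^ 2 := by
    simp only [hJ, hpow1]
  have hW6 : ∀ x, ‖W x‖ ^ 6 = ‖u x‖ ^ (3 * a) := fun x => by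
    have hn : 0 ≤ ‖u x‖ := norm_nonneg _
    show ‖‖u x‖ ^ s • u x‖ ^ 6 = ‖u x‖ ^ (3 * a)
    rw [norm_smul, Real.norm_of_nonneg (Real.rpow_nonneg hn _)]
    rcases eq_or_lt_of_le hn with hz | hpos
    · rw [← hz, Real.zero_rpow hs.ne', Real.zero_rpow (by positivity : (0 : ℝ) < 3 * a).ne']
      simp
    · rw [show ‖u x‖ ^ s * ‖u x‖ = ‖u x‖ ^ (s + 1) by rw [Real.rpow_add hpos, Real.rpow_one],
        ← Real.rpow_natCast, ← Real.rpow_mul hn]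
      congr 1; rw [hs_def]; push_cast; ring
  have hU : ∫ x, ‖u x‖ ^ (3 * a) = ∫ x, ‖W x‖ ^ 6 :=
    integral_congr_ae (ae_of_all _ fun x => (hW6 x).symm)
  -- (i) mean control and two-term splitting: `∫‖W‖⁶ ≤ 32 (1 + M) Φ`
  set Φ : ℝ := ∫ x, ‖W x - c‖ ^ 6 with hΦ
  have hΦ0 : 0 ≤ Φ := integral_nonneg fun x => pow_nonneg (norm_nonneg _) 6
  have hmean : ‖c‖ ^ 6 ≤ M * Φ := norm_integral_pow_six_le huc h0' hs
  have hsplit : ∫ x, ‖W x‖ ^ 6 ≤ 32 * (1 + M) * Φ := by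
    have hpt : ∀ x, ‖W x‖ ^ 6 ≤ 32 * ‖W x - c‖ ^ 6 + 32 * ‖c‖ ^ 6 := by
      intro x
      have h := norm_add_le (W x - c) c
      rw [sub_add_cancel] at h
      have hA := norm_nonneg (W x - c)
      have hB := norm_nonneg c
      have h2 : ‖W x‖ ^ 6 ≤ (‖W x - c‖ + ‖c‖) ^ 6 := pow_le_pow_left₀ (norm_nonneg _) h 6
      have h3 : (‖W x - c‖ + ‖c‖) ^ 6 ≤ 32 * (‖W x - c‖ ^ 6 + ‖c‖ ^ 6) := by
        -- convexity of `t ↦ t⁶`: `((A+B)/2)⁶ ≤ (A⁶+B⁶)/2`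
        have hconv := (convexOn_pow 6).2 (Set.mem_Ici.2 hA) (Set.mem_Ici.2 hB)
          (by norm_num : (0 : ℝ) ≤ 1 / 2) (by norm_num : (0 : ℝ) ≤ 1 / 2) (by norm_num)
        simp only [smul_eq_mul] at hconv
        have e : (1 / 2 * ‖W x - c‖ + 1 / 2 * ‖c‖) ^ 6 = (‖W x - c‖ + ‖c‖) ^ 6 / 64 := by ring
        rw [e] at hconv
        linarith
      linarith
    have hi1 : Integrable (fun x => ‖W x‖ ^ 6) volume := (hWc.norm.pow 6).integrable_unitAddTorus
    have hi2 : Integrable (fun x => 32 * ‖W x - c‖ ^ 6) volume :=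
      (((hWc.sub continuous_const).norm.pow 6).const_mul 32).integrable_unitAddTorus
    have hi3 : Integrable (fun _ : UnitAddTorus d => 32 * ‖c‖ ^ 6) volume := integrable_const _
    calc ∫ x, ‖W x‖ ^ 6 ≤ ∫ x, (32 * ‖W x - c‖ ^ 6 + 32 * ‖c‖ ^ 6) :=
          integral_mono hi1 (hi2.add hi3) hpt
      _ = 32 * Φ + 32 * ‖c‖ ^ 6 := by
          rw [integral_add hi2 hi3, integral_const_mul, integral_const]
          simp [hΦ]
      _ ≤ 32 * Φ + 32 * (M * Φ) := by linarith
      _ = 32 * (1 + M) * Φ := by ring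
  -- (ii) the regularised oscillation bound for every `ε > 0`
  set Wreg : ℝ → UnitAddTorus d → EuclideanSpace ℝ d :=
    fun ε x => (‖u x‖ ^ 2 + ε) ^ (s / 2) • u x with hWreg
  set creg : ℝ → EuclideanSpace ℝ d := fun ε => ∫ x, Wreg ε x with hcreg
  set Ψ : ℝ → ℝ := fun ε => ∫ x, ‖Wreg ε x - creg ε‖ ^ 6 with hΨ
  have hΨε : ∀ ε : ℝ, 0 < ε → Ψ ε ≤ CS * ((1 + s) ^ 2) ^ 3 * J ε ^ 3 := by
    intro ε hε
    have hWs : IsSmooth (Wreg ε) := isSmooth_reg hu hε (s / 2)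
    have hWεc : Continuous (Wreg ε) := hWs.continuous
    have hVs : IsSmooth (fun x => Wreg ε x - creg ε) := hWs.sub (isSmooth_const _)
    have hV0 : HasZeroMean (fun x => Wreg ε x - creg ε) := by
      show ∫ x, (Wreg ε x - creg ε) = 0
      rw [integral_sub hWεc.integrable_unitAddTorus (integrable_const _), integral_const]
      simp [hcreg]
    have hS := hCS _ hVs hV0
    have hg : gradNormSq (fun x => Wreg ε x - creg ε) = gradNormSq (Wreg ε) := by
      unfold gradNormSq
      refine integral_congr_ae (ae_of_all _ fun x => ?_)
      refine Finset.sum_congr rfl fun k _ => ?_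
      have e : (fun x => Wreg ε x - creg ε) = Wreg ε + fun _ => -creg ε := by
        funext y; simp [sub_eq_add_neg]
      have hcst : IsContDiff 1 (fun _ : UnitAddTorus d => -creg ε) := contDiff_const
      rw [e, partialDeriv_add (hWs.isContDiff (by simp)) hcst, Pi.add_apply]
      simp [Torus.partialDeriv, Torus.lineDeriv]
    have hG : gradNormSq (Wreg ε) ≤ (1 + s) ^ 2 * J ε := gradNormSq_reg_le hu hs.le hε
    have hG0 : 0 ≤ gradNormSq (Wreg ε) := gradNormSq_nonneg _
    calc Ψ ε = ∫ x, ‖Wreg ε x - creg ε‖ ^ 6 := rfl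
      _ ≤ CS * gradNormSq (fun x => Wreg ε x - creg ε) ^ 3 := hS
      _ = CS * gradNormSq (Wreg ε) ^ 3 := by rw [hg]
      _ ≤ CS * ((1 + s) ^ 2 * J ε) ^ 3 := by gcongr
      _ = CS * ((1 + s) ^ 2) ^ 3 * J ε ^ 3 := by ring
  -- (iii) continuity in `ε` and passage to `ε = 0`
  have hbase : Continuous fun p : ℝ × UnitAddTorus d => ‖u p.2‖ ^ 2 + p.1 :=
    ((huc.comp continuous_snd).norm.pow 2).add continuous_fst
  have hWj : Continuous (Function.uncurry Wreg) := by
    have h1 : Continuous fun p : ℝ × UnitAddTorus d => (‖u p.2‖ ^ 2 + p.1) ^ (s / 2) :=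
      hbase.rpow_const fun p => Or.inr (by positivity)
    exact h1.smul (huc.comp continuous_snd)
  have hcregc : Continuous creg := continuous_integral_param hWj
  have hΨc : Continuous Ψ := by
    refine continuous_integral_param ?_
    exact ((hWj.sub (hcregc.comp continuous_fst)).norm.pow 6)
  have hJc : Continuous J := by
    refine continuous_integral_param ?_
    exact (hbase.rpow_const fun p => Or.inr hs.le).mul (hcs.comp continuous_snd)
  have hΨ0 : Ψ 0 = Φ := by
    have hW0 : ∀ x, Wreg 0 x = W x := fun x => by
      show (‖u x‖ ^ 2 + 0) ^ (s / 2) • u x = ‖u x‖ ^ s • u x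
      rw [add_zero, ← Real.rpow_natCast, ← Real.rpow_mul (norm_nonneg _)]
      congr 2
      push_cast
      ring
    have hc0' : creg 0 = c := by
      show (∫ x, Wreg 0 x) = ∫ x, W x
      exact integral_congr_ae (ae_of_all _ hW0)
    show (∫ x, ‖Wreg 0 x - creg 0‖ ^ 6) = ∫ x, ‖W x - c‖ ^ 6
    refine integral_congr_ae (ae_of_all _ fun x => ?_)
    simp only [hW0, hc0']
  have hlim : Φ ≤ CS * ((1 + s) ^ 2) ^ 3 * J 0 ^ 3 := by
    -- the continuous function `ε ↦ CS (1+s)^6 J(ε)^3 − Ψ(ε)` is `≥ 0` on `(0, ∞)`, hence at `0`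
    have hφc : Continuous fun ε => CS * ((1 + s) ^ 2) ^ 3 * J ε ^ 3 - Ψ ε :=
      ((continuous_const.mul (hJc.pow 3)).sub hΨc)
    have ht : Tendsto (fun ε => CS * ((1 + s) ^ 2) ^ 3 * J ε ^ 3 - Ψ ε) (𝓝[>] 0)
        (𝓝 (CS * ((1 + s) ^ 2) ^ 3 * J 0 ^ 3 - Ψ 0)) :=
      (hφc.tendsto 0).mono_left nhdsWithin_le_nhds
    have hge : 0 ≤ CS * ((1 + s) ^ 2) ^ 3 * J 0 ^ 3 - Ψ 0 := by
      refine ge_of_tendsto ht ?_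
      filter_upwards [self_mem_nhdsWithin] with ε hε
      have := hΨε ε hε
      linarith
    rw [hΨ0] at hge
    linarith
  -- assemble
  have hJ00 : 0 ≤ J 0 := by
    rw [hJ0]
    exact integral_nonneg fun x => mul_nonneg (Real.rpow_nonneg (norm_nonneg _) _) (hcs0 x)
  rw [hU, ← hJ0]
  calc ∫ x, ‖W x‖ ^ 6 ≤ 32 * (1 + M) * Φ := hsplit
    _ ≤ 32 * (1 + M) * (CS * ((1 + s) ^ 2) ^ 3 * J 0 ^ 3) :=
        mul_le_mul_of_nonneg_left hlim (by positivity)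
    _ = 32 * (1 + M) * (CS * ((1 + s) ^ 2) ^ 3) * J 0 ^ 3 := by ring

/-- **Robinson–Sadowski 2014, Lemma 2 (periodic, zero-average case), printed shape.** On `T^d`,
`card d = 3`, for every real `a > 2` there is `c ≥ 0` such that for every smooth zero-mean vector
field `u : T^d → ℝ^d`,
`(∫ ‖u‖^{3a})^{1/3} = ‖u‖_{L^{3a}}^a ≤ c ∫ ‖u‖^{a−2} ∑ₖ ‖∂ₖu‖²`.
[cite: RobinsonSadowski2014, Lemma 2 (p. 164)] -/
theorem exists_rpow_integral_norm_rpow_le_weighted (hd : Fintype.card d = 3) {a : ℝ}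
    (ha : 2 < a) :
    ∃ c : ℝ, 0 ≤ c ∧ ∀ u : UnitAddTorus d → EuclideanSpace ℝ d, IsSmooth u → HasZeroMean u →
      (∫ x, ‖u x‖ ^ (3 * a)) ^ (1 / 3 : ℝ) ≤
        c * ∫ x, ‖u x‖ ^ (a - 2) * ∑ k, ‖partialDeriv k u x‖ ^ 2 := by
  obtain ⟨K, hK0, hK⟩ := exists_integral_norm_rpow_three_mul_le_cube (d := d) hd ha
  refine ⟨K ^ (1 / 3 : ℝ), Real.rpow_nonneg hK0 _, fun u hu h0 => ?_⟩
  have h := hK u hu h0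
  have hI0 : 0 ≤ ∫ x, ‖u x‖ ^ (a - 2) * ∑ k, ‖partialDeriv k u x‖ ^ 2 :=
    integral_nonneg fun x => mul_nonneg (Real.rpow_nonneg (norm_nonneg _) _)
      (Finset.sum_nonneg fun k _ => sq_nonneg _)
  have hA0 : 0 ≤ ∫ x, ‖u x‖ ^ (3 * a) :=
    integral_nonneg fun x => Real.rpow_nonneg (norm_nonneg _) _
  calc (∫ x, ‖u x‖ ^ (3 * a)) ^ (1 / 3 : ℝ)
      ≤ (K * (∫ x, ‖u x‖ ^ (a - 2) * ∑ k, ‖partialDeriv k u x‖ ^ 2) ^ 3) ^ (1 / 3 : ℝ) :=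
        Real.rpow_le_rpow hA0 h (by norm_num)
    _ = K ^ (1 / 3 : ℝ) * ∫ x, ‖u x‖ ^ (a - 2) * ∑ k, ‖partialDeriv k u x‖ ^ 2 := by
        rw [Real.mul_rpow hK0 (by positivity), ← Real.rpow_natCast _ 3,
          ← Real.rpow_mul hI0]
        norm_num

end Torus

end Literature.Analysis.FunctionSpaces
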